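import Literature.NumberTheory.Automorphic.BaseChangeArchimedeanCentralCharacter
import Literature.NumberTheory.Automorphic.GLOneArchParameterOfAlgebraicCharacter
import HarnessLib

/-!
# The infinity type of the central character of an automorphic representation of `GL_n(𝔸_K)`
(crux `IrreducibilityBySelfDuality.RegularAdjointLiftCM`, item stmt-Langlands-13617, line
`nu-cubed-central-character`, stub `stub_centralCharacterInfinityType`)

Let `π = W / W'` be an automorphic representation of `GL_n(𝔸_K)` in the Borel–Jacquet model of the
tree (`AutomorphicRepData (AutomorphyDatum.gl n K hcpt)`; any `n`, any number field `K`, not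
necessarily cuspidal), `ω` a Hecke character through which the centre acts on `W / W'`
(`r(z · 1_n) φ - ω(z) φ ∈ W'`, `AutomorphicRepData.exists_centralCharacter`), and `T` an infinity type
of `π` whose `a`-sums are integers: `∑_{(a, b) ∈ T ι} a = A ι ∈ ℤ` for every `ι : K → ℂ`.
Then `ω` is an algebraic Hecke character of infinity type `(p, q)` with `p_w = -A_{ι_w}` and
`q_w = -A_{ῑ_w}` at a complex place, `q_w = 0` at a real one (`HeckeCharacter.HasInfinityType`):
`ω((x, 1)) = ∏_{w real} ι_w(x_w)^{A_{ι_w}} ∏_{w complex} ι_w(x_w)^{A_{ι_w}} conj(ι_w(x_w))^{A_{ῑ_w}}`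
for every totally positive `x ∈ (K ⊗ ℝ)ˣ`.

This is word for word the `GL₁` theorem
`AutomorphicRepData.exists_hasInfinityType_heckeCharacter_glOne` (`ReciprocityGLnRankOneProofs`)
with the centre of `𝔤𝔩_n` in place of `𝔤𝔩₁`: the central
`x · 1_n ∈ 𝔤𝔩_n(K_∞)` acts on `W / W'` by the scalar
`s(x) = ∑_{w real} x_w A_{ι_w} + ∑_{w complex} (x_w A_{ι_w} + x̄_w A_{ῑ_w})`
(`AutomorphicRepData.HasArchParameter.lieDeriv_scalar_sub_smul_mem`), hence
`ω(det (exp Y, 1)) = e^{s(Y)}` along the archimedean exponential ideles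
(`AutomorphicRepData.centralCharacter_det_ofInfinite_expGL`), and every totally positive infinite idele
is `det (exp Y, 1)` for its coordinatewise logarithm `Y` (`extensionEmbedding_det_ofInfinite_expGL`),
while `e^{A log z} = z^A` for `A ∈ ℤ`.

References: L. Clozel, *Motifs et formes automorphes* (1990), §1.1, §3.3 (the central character of an
algebraic `π` is an algebraic Grössencharacter); A. Weil, *On a certain type of characters of the
idèle-class group of an algebraic number-field* (1956), §1 (type `A₀`); A. Borel, H. Jacquet,
Corvallis (1979), §4.6 and 5.7.
-/

open scoped BigOperators Topology Classical ComplexConjugate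
open Filter Set Function IsDedekindDomain NumberField
open Literature.NumberTheory.Automorphic
open Literature.NumberTheory.GaloisRepresentations (HeckeCharacter ideleGroup)

-- `Summit.Langlands.Langlands.…` (problem = summit name, D-0017 layout) trips `dupNamespace` on
-- every declaration; the lakefile sets the same option for the `Summits` library.
set_option linter.dupNamespace false

noncomputable section

namespace Summit.Langlands.Langlands.Theorems.RegularAdjointLiftCM

open NumberField.InfinitePlace NumberField.mixedEmbedding
open Literature.NumberTheory.GaloisRepresentations

/-! ### The registered stub -/

/-- **Stub `stub_centralCharacterInfinityType`** of the line `nu-cubed-central-character` for the crux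
`RegularAdjointLiftCM` (**the central character of a representation with an infinity type whose
`a`-sums are integral is an algebraic Hecke character of type `(-A_{ι_w}, -A_{ῑ_w})`**, at a real place
`(-A_{ι_w}, 0)`).  For `π = W / W'` on `GL_n(𝔸_K)`, `ω` a Hecke character through which the centre
acts, `T` an infinity type of `π` with `∑ (a : T ι) = A ι ∈ ℤ`:
`ω((x, 1)) = ∏_w ι_w(x_w)^{A_{ι_w}} conj(ι_w(x_w))^{A_{ῑ_w}}` (the second factor only at
complex `w`) for all totally positive `x ∈ (K ⊗ ℝ)ˣ`, a neighbourhood of `1`.  The central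
`x · 1_n ∈ 𝔤` acts by
`s(x) = ∑_{w real} x_w A_{ι_w} + ∑_{w complex} (x_w A_{ι_w} + x̄_w A_{ῑ_w})`
(`HasArchParameter.lieDeriv_scalar_sub_smul_mem`), so `ω(det (exp Y, 1)) = e^{s(Y)}`
(`centralCharacter_det_ofInfinite_expGL`), and a totally positive `x` is `det (exp Y, 1)` for the
coordinatewise logarithm `Y` (`extensionEmbedding_det_ofInfinite_expGL`).  Clozel 1990, §1.1
and §3.3; Weil 1956, §1. [cite: Clozel1990, §3.3] -/
theorem stub_centralCharacterInfinityType :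
    ∀ (K : Type) [Field K] [NumberField K] (n : ℕ) (hcpt : isCompact_glFiniteIntegralLevel n K)
      (π : AutomorphicRepData (AutomorphyDatum.gl n K hcpt)) (ω : HeckeCharacter K),
      (∀ (z : ideleGroup K), ∀ φ ∈ π.W, rightTranslation (AdelicGroupData.gl n K)
          (Matrix.GeneralLinearGroup.scalar (Fin n) z) φ - ((ω z : ℂˣ) : ℂ) • φ ∈ π.W') →
      ∀ (T : InfinityType K n), π.HasInfinityType T →
      ∀ (A : (K →+* ℂ) → ℤ), (∀ ι : K →+* ℂ, ((T ι).map ArchWeight.a).sum = (A ι : ℂ)) →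
        ω.HasInfinityType (fun w => -A w.embedding)
          (fun w => if w.IsReal then 0 else -A (ComplexEmbedding.conjugate w.embedding)) := by
  intro K _ _ n hcpt π ω hω T hT A hA
  -- the scalar `s(x)` of the central `x · 1_n ∈ 𝔤` on `W / W'`
  set s : mixedSpace K → ℂ := fun x =>
    ∑ w : {w : InfinitePlace K // IsReal w}, (x.1 w : ℂ) * (A w.1.embedding : ℂ) +
      ∑ w : {w : InfinitePlace K // IsComplex w},
        (x.2 w * (A w.1.embedding : ℂ) +
          conj (x.2 w) * (A (ComplexEmbedding.conjugate w.1.embedding) : ℂ)) with hs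
  have hd : ∀ (x : mixedSpace K), ∀ φ ∈ π.W, lieDeriv (AutomorphyDatum.gl n K hcpt).ofArch
      (⟨Matrix.scalar (Fin n) x, trivial⟩ : (AutomorphyDatum.gl n K hcpt).arch.lie) φ -
        s x • φ ∈ π.W' := by
    intro x φ hφ
    have h := hT.2.lieDeriv_scalar_sub_smul_mem x hφ
    simp only [hA] at h
    exact h
  -- the link `ω(det (exp Y, 1)) = e^{s(Y)}`
  have hlink : ∀ Y : Matrix (Fin 1) (Fin 1) (mixedSpace K),
      ((ω (Matrix.GeneralLinearGroup.det (GLn.ofInfinite 1 K (expGL Y))) : ℂˣ) : ℂ) =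
        Complex.exp (s (Y 0 0)) :=
    fun Y => π.centralCharacter_det_ofInfinite_expGL hω hd Y
  refine ⟨{x | InfiniteIdele.IsTotallyPositive x}, ?_, fun x hx => ?_⟩
  · -- the totally positive infinite ideles form a neighbourhood of `1`
    have hpos : ∀ w : {w : InfinitePlace K // w.IsReal}, ∀ᶠ x : (InfiniteAdeleRing K)ˣ in 𝓝 1,
        0 < Completion.extensionEmbeddingOfIsReal w.2 ((x : InfiniteAdeleRing K) w.1) := by
      intro w
      have hc : Continuous fun x : (InfiniteAdeleRing K)ˣ =>
          Completion.extensionEmbeddingOfIsReal w.2 ((x : InfiniteAdeleRing K) w.1) :=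
        (Completion.isometry_extensionEmbeddingOfIsReal w.2).continuous.comp
          ((continuous_apply w.1).comp Units.continuous_val)
      refine (isOpen_lt continuous_const hc).mem_nhds ?_
      show (0 : ℝ) < Completion.extensionEmbeddingOfIsReal w.2 1
      rw [map_one]
      exact one_pos
    filter_upwards [eventually_all.2 hpos] with x hx
    exact fun w hw => hx ⟨w, hw⟩
  · -- the identity `ω((x, 1)) = ∏_w ι_w(x_w)^{A_{ι_w}} conj(ι_w(x_w))^{A_{ῑ_w}}` at such an `x`
    -- the coordinatewise logarithm `y` of `x` and `Y = y · 1 ∈ 𝔤𝔩₁(K_∞)`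
    obtain ⟨y, hy1, hy2⟩ : ∃ y : mixedSpace K,
        (∀ w : {w : InfinitePlace K // w.IsReal}, y.1 w =
          Real.log (Completion.extensionEmbeddingOfIsReal w.2 ((x : InfiniteAdeleRing K) w.1))) ∧
        ∀ w : {w : InfinitePlace K // w.IsComplex},
          y.2 w = Complex.log (Completion.extensionEmbedding w.1 ((x : InfiniteAdeleRing K) w.1)) :=
      ⟨(fun w =>
          Real.log (Completion.extensionEmbeddingOfIsReal w.2 ((x : InfiniteAdeleRing K) w.1)),
        fun w => Complex.log (Completion.extensionEmbedding w.1 ((x : InfiniteAdeleRing K) w.1))),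
        fun _ => rfl, fun _ => rfl⟩
    have hY00 : (y • (1 : Matrix (Fin 1) (Fin 1) (mixedSpace K))) 0 0 = y := by
      rw [Matrix.smul_apply, Matrix.one_apply_eq, smul_eq_mul, mul_one]
    -- `(x, 1) = det (exp Y, 1)` as ideles
    have hxY : infiniteIdeles K x = Matrix.GeneralLinearGroup.det
        (GLn.ofInfinite 1 K (expGL (y • (1 : Matrix (Fin 1) (Fin 1) (mixedSpace K))))) := by
      refine idele_eq_of_snd_eq_of_extensionEmbedding_eq K ?_ fun w => ?_
      · rw [det_ofInfinite_snd]
        rfl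
      · rw [extensionEmbedding_det_ofInfinite_expGL, hY00, infiniteIdeles_fst]
        by_cases hw : w.IsReal
        · rw [dif_pos hw, hy1 ⟨w, hw⟩, Real.exp_log (hx w hw),
            Completion.extensionEmbeddingOfIsReal_apply]
        · rw [dif_neg hw, hy2 ⟨w, not_isReal_iff_isComplex.1 hw⟩,
            Complex.exp_log (InfiniteIdele.extensionEmbedding_apply_ne_zero x w)]
    rw [hxY, hlink, hY00, hs]
    dsimp only
    rw [Complex.exp_add, Complex.exp_sum, Complex.exp_sum, HeckeCharacter.archFactor_apply,
      prod_eq_prod_mul_prod]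
    congr 1
    · -- real places
      refine Finset.prod_congr rfl fun w _ => ?_
      rw [if_pos w.2, neg_zero, zpow_zero, mul_one, neg_neg, mul_comm, Complex.exp_int_mul,
        hy1 w, ← Complex.ofReal_exp, Real.exp_log (hx w.1 w.2),
        Completion.extensionEmbeddingOfIsReal_apply]
    · -- complex places
      refine Finset.prod_congr rfl fun w _ => ?_
      have hw : ¬ w.1.IsReal := not_isReal_iff_isComplex.2 w.2
      rw [if_neg hw, neg_neg, neg_neg, Complex.exp_add, mul_comm (y.2 w),
        mul_comm (conj (y.2 w)), Complex.exp_int_mul, Complex.exp_int_mul, hy2 w, Complex.exp_conj,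
        Complex.exp_log (InfiniteIdele.extensionEmbedding_apply_ne_zero x w.1)]

end Summit.Langlands.Langlands.Theorems.RegularAdjointLiftCM

end
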